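import Literature.Geometry.Riemannian.GurskyViaclovskyPath
import HarnessLib
import Literature.Geometry.Riemannian.GurskyViaclovskyClosedness

/-!
# Stub `stub_pathClosed` of line `gv-continuity-path` (crux `EntropyRung.ChangGurskyYang`),
# closed MODULO the closedness of Gursky–Viaclovsky's solvable set along the Weyl-weighted path
# (Gursky–Viaclovsky 2003, Prop. 6 and §5; analytic inputs Evans 1982 / Krylov 1983, Schauder)

STUB 6 of the lead's skeleton of line `gv-continuity-path` (crux stmt-SmoothPoincare4-10834,
`Summit.SmoothPoincare4.SmoothPoincare4.Theses.EntropyRung.ChangGurskyYang`; hypothesis `hClosed` of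
its `thm14Psc_of`, the continuity method) is the CLOSEDNESS of the solvable set `𝒮` of the
continuity method of Gursky–Viaclovsky (J. Differential Geom. 63 (2003) 131–154,
arXiv:math/0301350, §5, p. 9 of the arXiv text). The source, Prop. 6: "Let `u_t` be a `C⁴` solution
of (path) for some `δ ≤ t ≤ 1` satisfying `δ̲ < u_t < δ̄`, and `‖∇u_t‖_{L^∞} < C₁`. Then for
`0 < α < 1`, `‖u_t‖_{C^{2,α}} ≤ C₂`, where `C₂` depends only upon `δ̲, δ̄, C₁`, and `g`. Proof. The
`C²` estimate follows from the global estimates in [GVNegative], or the local estimates [GuanWang1]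
and [LiLi2] … Since `f(x) > 0`, the `C²` estimate implies uniform ellipticity, and the `C^{2,α}`
estimate then follows from the work of [Krylov] and [Evans] on concave, uniformly elliptic
equations."; and the proof of Thm. 1 (ibid.): "`𝒮 = {t ∈ [δ, t₀] | ∃ a solution u_t ∈ C^{2,α}(M)
of (path) with A^t_{u_t} ∈ Γ₂⁺}` … Note that since `f ∈ C^∞(M)`, it follows from classical
elliptic regularity theory that `u_t ∈ C^∞(M)`. Proposition (upper) implies a uniform upper bound
on solutions `u_t` (independent of `t`). We may then apply Proposition (C1estimate) to obtain a
uniform gradient bound, and Lemma (C0) then implies a uniform lower bound on `u_t`. Proposition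
(C2estimate) then implies that `𝒮` is closed". The `C²` half of Prop. 6 is the separate stub
`stub_pathHessian` (named fact `gurskyViaclovsky_hessianEstimate_weighted_four`,
`GurskyViaclovskyC2Estimate.lean`); THIS stub is the remaining content of "implies that `𝒮` is
closed": from a sequence of parameters `t_k → t`, `t_k ≤ 1`, carrying smooth admissible solutions
with UNIFORM bounds on `|u_k|`, `|∇u_k|²_g`, `|∇²u_k|²_g`, produce a smooth admissible solution at
`t`. Unpacked (the standard argument the source compresses into one sentence):
(i) by the `C²` bounds the arguments `g⁻¹A^{t_k}_{u_k}` range in a bounded set, on which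
`σ₂ = F(x,u_k)² ≥ c > 0` (positivity of the right-hand side along `|u_k| ≤ C`), and `σ₂ ≥ c > 0`
with `σ₁ ≥ 0` forces `σ₁ > 0` (`σ₁ = 0` gives `σ₂ = −½|A|² ≤ 0`), so they range in a compact subset
of the open cone `Γ₂⁺ = {σ₂ > 0} ∩ {σ₁ > 0}` (ibid. Def. 1), on which `σ₂^{1/2}` is concave and
uniformly elliptic (ibid. Prop. 1 (ii): `T₁(A) > 0` on `Γ₂⁺`, and `L^t(A) ≥ T₁(A)` for `t ≤ 1`) —
"the `C²` estimate implies uniform ellipticity"; (ii) Evans 1982 / Krylov 1983 (textbook form: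
Gilbarg–Trudinger, Thm. 17.14, the interior `C^{2,α}` estimate for `F[u] = F(x, u, Du, D²u) = 0`
with `F` concave in `D²u` and uniformly elliptic along `u`, constants depending on `|u|_{2}`), in
finitely many charts of the compact `M`: uniform `C^{2,α}` bounds; (iii) Arzelà–Ascoli: a
subsequence converges in `C²` to a `C^{2,α}` solution at the limit parameter `t`, admissible by (i);
(iv) Schauder bootstrap (Gilbarg–Trudinger, Lemma 17.16: a `C²` solution of a smooth equation
elliptic along it is `C^∞`) — "classical elliptic regularity theory"; (v) the conformal metric
`h = e^{−2u} g` is then a `C^∞` Riemannian metric carrying its Levi-Civita connection, with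
`R_h > 0` (`σ₁(g⁻¹A^t_u) = e^{−2u}(3−2t)R_h/6 > 0`, `t ≤ 1`) and `pathOperator h t = q e^{8u}`.

THE WEIGHT. Gursky–Viaclovsky print the path `σ₂^{1/2}(g⁻¹A^t_u) = f(x)e^{2u}`; this line runs the
WEYL-WEIGHTED path of Chang–Gursky–Yang 2003, (1.10) (`α = 1`), read on the conformal metric
(`GurskyViaclovskyPath.lean`, module docstring "Dictionary": `P_t(h) = σ₂(A_h) − ¼|W_h|² +
(1−t)(2−t)R_h²/6 = q e^{8u}` on `h = e^{−2u}g` is, on the background `g`,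
`σ₂^{1/2}(g⁻¹A^t_u) = F(x,u) := ((1/16)|W_g|²_g + (q/4)e^{4u})^{1/2}`). The weight enters only
through the right-hand side `F(x, u)`, a `C^∞` function of `(x, u)` bounded below by
`((min q)/4)^{1/2} e^{−2C} > 0` along `|u| ≤ C`; the Evans–Krylov and Schauder theorems are stated
for general smooth `F(x, z, p, r)` concave in `r`, so the `x`- and `u`-dependence of the weight
changes constants only — Gursky–Viaclovsky, §1 (p. 4): "The choice of the right hand side in (PDE)
is quite flexible; the key requirement is simply that the exponent is a positive multiple of `u`".

None of the Hölder-space elliptic theory this needs (Evans–Krylov `C^{2,α}` estimates, Schauder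
estimates and the regularity bootstrap on a closed manifold) exists in Mathlib or in the tree;
only Arzelà–Ascoli does. Following the NEED-A-PUBLISHED-FACT rule, this file

* STATES the printed closedness step, specialised to exactly what the stub consumes, as the named
  fact `gurskyViaclovsky_pathClosed_weighted_four` (written inline by this line WITHOUT scoped
  notation and with fully qualified tree names, so that it elaborates under any preamble; to be
  relocated by the gate to `Literature/Geometry/Riemannian/GurskyViaclovskyClosedness.lean`);
* PROVES the stub conditionally on it: `stub_pathClosed_of_pathClosed` (the registered statement
  of `stub_pathClosed` VERBATIM after the hypothesis; colon form
  `gurskyViaclovsky_pathClosed_weighted_four → <stub_pathClosed verbatim>`), by definitional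
  unfolding: the fact is the stub statement with `𝓡 4`, `𝓘(ℝ)`, `∞`, `Tendsto … atTop (𝓝 t)`
  written out.

So `stub_pathClosed` is exactly `stub_pathClosed_of_pathClosed hC` for
`hC : Literature.Geometry.Riemannian.gurskyViaclovsky_pathClosed_weighted_four`, and the line is closed at this leaf MODULO the
named fact. Nothing here is shaped like the crux, like Chang–Gursky–Yang's Thm. 1.4 or like
Gursky–Viaclovsky's Thm. 1: the fact takes a whole sequence of bounded solutions as INPUT and
returns one solution at the limit parameter (the compactness step only; existence, openness and
the a-priori bounds are the neighbouring stubs).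

References: M. J. Gursky, J. A. Viaclovsky, *A fully nonlinear equation on four-manifolds with
positive scalar curvature*, J. Differential Geom. 63 (2003) 131–154, arXiv:math/0301350: §1 ((PDE)
and the remark on its right-hand side, p. 4), §2 (Def. 1: `Γ₂⁺`; Prop. 1), §5 (Prop. 6 and the
proof of Thm. 1: the set `𝒮`, p. 9) [GurskyViaclovsky2003]; L. C. Evans, *Classical solutions of
fully nonlinear, convex, second-order elliptic equations*, Comm. Pure Appl. Math. 35 (1982)
333–363 [Evans1982]; N. V. Krylov, *Boundedly inhomogeneous elliptic and parabolic equations in a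
domain*, Izv. Akad. Nauk SSSR Ser. Mat. 47 (1983) 75–108 = Math. USSR-Izv. 22 (1984) 67–97
[Krylov1984]; D. Gilbarg, N. S. Trudinger, *Elliptic Partial Differential Equations of Second
Order* (2001), §17.4, Thm. 17.14, and Lemma 17.16 [GilbargTrudinger2001]; S.-Y. A. Chang,
M. J. Gursky, P. C. Yang, Publ. Math. IHÉS 98 (2003) 105–143, (1.10) [ChangGurskyYang2003].
-/

noncomputable section
open scoped Manifold ContDiff Topology
open Set Filter
open Literature.Geometry.Lorentzian (PseudoRiemannianMetric)
open Literature.Geometry.Lorentzian.PseudoRiemannianMetric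
open Literature.Geometry.Riemannian
open Literature.Geometry.Riemannian.GurskyViaclovskyPath

namespace Summit.SmoothPoincare4.SmoothPoincare4.Theorems.GvContinuityPath
set_option linter.dupNamespace false -- the problem path `SmoothPoincare4.SmoothPoincare4` repeats a segment by design

/-- **STUB 6 of line `gv-continuity-path` (`stub_pathClosed`, verbatim after the hypothesis),
conditional on the closedness fact `gurskyViaclovsky_pathClosed_weighted_four`
(Gursky–Viaclovsky 2003, Prop. 6 and §5, "Proposition (C2estimate) then implies that `𝒮` is
closed", along the Weyl-weighted path; Evans 1982 / Krylov 1983 `C^{2,α}` estimates, Schauder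
bootstrap, Arzelà–Ascoli).** On a closed connected `(M⁴, g)`, for a smooth positive right side
`q` and a level `C`: if `s_k → t` with `s_k ≤ 1` and at every `s_k` the weighted path equation
`P_{s_k}(h) = q e^{8u}` has a smooth admissible solution `(h = e^{−2u} g, u)` with `|u| ≤ C`,
`|∇u|²_g ≤ C` and `|∇²u|²_g ≤ C`, then it has a smooth admissible solution at `t`
(`Solvable g t q`). Proof: the named fact is this statement with the scoped notations `𝓡 4`,
`𝓘(ℝ)`, `∞`, `Tendsto … atTop (𝓝 t)` written out, so it closes the stub by definitional
unfolding. [cite: GurskyViaclovsky2003, Prop. 6 and §5 (proof of Thm. 1)] [cite: Evans1982]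
[cite: Krylov1984] -/
theorem stub_pathClosed_of_pathClosed :
    Literature.Geometry.Riemannian.gurskyViaclovsky_pathClosed_weighted_four →
    ∀ (M : Type) [TopologicalSpace M] [T2Space M] [SecondCountableTopology M]
      [ChartedSpace (EuclideanSpace ℝ (Fin 4)) M] [IsManifold (𝓡 4) ∞ M] [CompactSpace M]
      [ConnectedSpace M]
      (g : PseudoRiemannianMetric (𝓡 4) ∞ (EuclideanSpace ℝ (Fin 4)) (TangentSpace (𝓡 4) : M → Type _))
      [g.HasLeviCivita], g.IsRiemannian →
      ∀ (q : M → ℝ) (C : ℝ), ContMDiff (𝓡 4) 𝓘(ℝ) ∞ q → (∀ x, 0 < q x) →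
      ∀ (s : ℕ → ℝ) (t : ℝ), Tendsto s atTop (𝓝 t) → (∀ k, s k ≤ 1) →
        (∀ k, ∃ (h : PseudoRiemannianMetric (𝓡 4) ∞ (EuclideanSpace ℝ (Fin 4)) (TangentSpace (𝓡 4) : M → Type _))
          (_ : h.HasLeviCivita) (u : M → ℝ), IsPathSolution g h u (s k) q ∧
            ∀ x, |u x| ≤ C ∧ g.gradSq u x ≤ C ∧ g.normSq x (g.hessian u x) ≤ C) →
        Solvable g t q :=
  fun hC ↦ hC

end Summit.SmoothPoincare4.SmoothPoincare4.Theorems.GvContinuityPath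
end
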